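import Summits.BirchSwinnertonDyer.BirchSwinnertonDyer.Theorems.GenusKolyvaginAtTwoMinimalTwinBSDTwoRouteLedgerLine25
import HarnessLib

/-!
# Route `GenusKolyvaginAtTwo` (rev 57): U₂ `MinimalTwinBSDTwo` (stmt-BirchSwinnertonDyer-22985) for the purpose of `closes` ⟸
# «the rank-zero WALL (sliced to two cells) + the two reversed 2-Selmer-trivial Heegner twin supplies S2″, S2⁻′ + PRINT»

Seat `bsd-line-gk2-p3` g28 (PROVER seat 3/3, cell `bsd-f1-sign2`), `--supports stmt-BirchSwinnertonDyer-22985` (helper; closes nothing).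
THEOREMS ONLY (no definition, no named fact, no `sorry`); standard axioms.  **BSD is NOT proved by this file; U₂ / hTw0 / hTw1 / S1 / S2″ /
S2⁻′ are NOT proved; no item is closed.**  Everything is CONDITIONAL on the displayed hypotheses (the route's items as in `closes`, the wall,
the two reversed supplies — beyond print as stated — and the four STATEMENT-ONLY print facts GZ / GZK / modularity / Milne).  This is the
rev-57 successor of this seat's `…RouteLedgerOfReversedSupplies` (p767868) and of the pending `…RouteLedgerOfReversedSuppliesWallSliced`
(p768116), both rev-53 modules that stopped elaborating when rev 57 removed `def OffCutResidualAtTwo` (see `…RouteLedgerLine25`, header).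

* §1 **`hTw0_of_slicedWall_of_reversedSupplyExponent_of_facts`** — `hTw0 = (Δ > 0, ord₂ C = 0)` ⟸ S1⁺ + S2″ + PRINT, S1⁺ := `BSD₂` for non-CM
  globally minimal `W` with `r_an = 0`, `#Sel₂ = 1`, `0 < Δ`, `ord₂ C(W) = 0`; S2″ := LINE 23 v1.3's `ReversedMinimalSupplyAtTwoExponent`
  VERBATIM (gk2-p2 g23); engine g23's Manin-free `swappedPairDescentAtTwo_maninExponent_of_facts` (p766443) BY NAME; the twin handed to the
  wall has `Δ(Wd) > 0` (twist-invariance of `sign Δ`) and `ord₂ C(Wd) = 0` (S2″'s budget on `Δ > 0`), `r_an(Wd) = 0` (g23's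
  `analyticRank_twist_eq_zero_of_rankOne`), non-CM (same `j`).
  **`hTw1_of_slicedWall_of_reversedSupplyDepthOnePrime_of_facts`** — `hTw1 = (Δ < 0, ord₂ C = 1)` ⟸ S1⁻ + S2⁻′ + PRINT, S1⁻ := the wall on
  (`r_an = 0`, `#Sel₂ = 1`, `Δ < 0`, `ord₂ C = 2`); S2⁻′ := the PRIME-frame reversed supply at depth `ord₂ c + 1` (binder `hS2p`, this seat
  p767140 verbatim); engine `OneBit.swappedPairDescentAtTwo_tamagawaDepth_of_facts` (p766822); the twin has `Δ(Wd) < 0` and `ord₂ C(Wd) =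
  ord₂ C(W) + 1 = 2` (`OneBit.padicValNat_two_tamagawaProduct_twin_eq_succ_of_discr_eq_neg_prime`, unconditional).
* §2 **`nonCMAtTwo_of_items_of_slicedWall_of_reversedSupplies_line25`** — `closes` (rev 57) with `hTw` REPLACED by S1⁺ + S1⁻ + S2″ + S2⁻′
  (`Line25.nonCMAtTwo_of_items_of_tamagawaSlicedTwin_line25` fed by §1); **`nonCMAtTwo_of_items_of_wall_of_reversedSupplies_line25`** — the
  same with the unsliced wall S1 (LINE 23's anchor `MinimalRankZeroBSDTwo` verbatim: non-CM, `r_an = 0`, `#Sel₂ = 1` ⟹ `BSD₂`).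
  NET (planner currency, rev 57): **U₂|`closes` ⟸ S1|{(Δ>0, C odd), (Δ<0, ord₂ C = 2)} + S2″ + S2⁻′ + PRINT.**

References: [GrossZagier1986] V.§2 (2.2); [GrossLMS1991] §5; [Kramer1981] Thm. 1, §2 Prop. 3; [Milne1972ArithmeticAV] §1 Thm. 1;
[SilvermanAEC2009] III.1 Table 3.1; [Miller2011LMS] Def. 1.1.
-/

set_option autoImplicit false
set_option linter.dupNamespace false -- `Summit.<P>.<Sub>` repeats `BirchSwinnertonDyer` (D-0017)

noncomputable section

open scoped Classical

open WeierstrassCurve NumberField Literature.NumberTheory.EllipticCurves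
  Literature.NumberTheory.EllipticCurves.ModularForms
  Literature.NumberTheory.EllipticCurves.Rank1Residual
  Literature.NumberTheory.EllipticCurves.Rank1Residual.Typed
  Literature.NumberTheory.EllipticCurves.KrizLi2019
  Summit.BirchSwinnertonDyer.Rank1Residual
  Summit.BirchSwinnertonDyer.Rank1Residual.AdditivePotMult
  Summit.BirchSwinnertonDyer.BirchSwinnertonDyer.Rank1Residual
  Summit.BirchSwinnertonDyer.BirchSwinnertonDyer.Theses.GenusKolyvaginAtTwo
  Summit.BirchSwinnertonDyer.BirchSwinnertonDyer.Theorems.CMExactDescent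
  Summit.BirchSwinnertonDyer.BirchSwinnertonDyer.Theorems.GenusExact.TwinSwap
  Summit.BirchSwinnertonDyer.BirchSwinnertonDyer.Theorems.GenusExact.TwinSwap.OneBit
  Summit.BirchSwinnertonDyer.BirchSwinnertonDyer.Theorems.GenusExact.PlusDescent

namespace Summit.BirchSwinnertonDyer.BirchSwinnertonDyer.Theorems.GenusExact.TwinSwap.Ledger.Line25

/-! ## §1 The two cells from the SLICED wall and the reversed supplies -/

/-- **`hTw0 ⟸ S1⁺ + S2″ + PRINT`** — this seat's `Ledger.hTw0_of_wall_of_reversedSupplyExponent_of_facts` (p767868, rev-53 module) with S1 sliced to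
S1⁺ = (`r_an = 0`, `#Sel₂ = 1`, `Δ > 0`, `C` odd): the all-silent twin of a `Δ > 0`, `C(W)`-odd curve has `Δ(Wd) > 0` and `ord₂ C(Wd) = 0`.
[cite: GrossZagier1986, V.§2 (2.2)] [cite: SilvermanAEC2009, III.1 Table 3.1] [cite: Miller2011LMS, Def. 1.1] -/
theorem hTw0_of_slicedWall_of_reversedSupplyExponent_of_facts
    (hGZ : ∀ (N : ℕ) [NeZero N] (W : WeierstrassCurve ℚ) (K : Type) [Field K] [NumberField K], gross_zagier N W K)
    (hGZK : rank_eq_analyticRank_of_analyticRank_le_one) (hmod : hasEntireLFunction_rat)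
    (hMilneC : Milne1972.bsdQuotient_baseChange_quadratic_anyModel)
    (hS1pos : ∀ (W : WeierstrassCurve ℚ) [W.IsElliptic] [W.IsGloballyMinimal],
      ¬ W.HasCM → W.analyticRank = 0 → Nat.card (W.selmerGroup 2) = 1 → 0 < W.Δ → padicValNat 2 W.tamagawaProduct = 0 → BSDp W 2)
    (hS2e : ∀ (W : WeierstrassCurve ℚ) [W.IsElliptic] [W.IsGloballyMinimal] [NeZero (W.conductorNorm ℤ)],
      ¬ W.HasCM → W.analyticRank = 1 → Nat.card (W.selmerGroup 2) = 2 → Odd W.tamagawaProduct →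
      ∃ (K : Type) (_ : Field K) (_ : NumberField K),
        IsImaginaryQuadratic K ∧ Odd (NumberField.discr K) ∧ NumberField.discr K ≠ -3 ∧ SatisfiesHeegnerHypothesis (W.conductorNorm ℤ) K ∧
        ∃ (Dt : ModularParametrizationData W (W.conductorNorm ℤ)) (β : ℤ) (ι : K →+* ℂ) (d₁ : KolyvaginHeegnerData Dt β ι 1),
          Dt.c ≠ 0 ∧ ¬ IsOfFinAddOrder d₁.derivedPoint ∧
          (∃ M₀ : ℕ, padicValInt 2 Dt.c = M₀ ∧
            (∃ Q : (W.baseChange (ringClassField K ι 1)).toAffine.Point, ((2 ^ M₀ : ℕ) : ℤ) • Q = d₁.derivedPoint) ∧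
            (¬ ∃ Q : (W.baseChange (ringClassField K ι 1)).toAffine.Point, ((2 ^ (M₀ + 1) : ℕ) : ℤ) • Q = d₁.derivedPoint)) ∧
          ∃ (Wd : WeierstrassCurve ℚ) (_ : Wd.IsElliptic) (_ : Wd.IsGloballyMinimal),
            (∃ C : VariableChange ℚ, C • W.quadraticTwist (NumberField.discr K : ℚ) = Wd) ∧ Nat.card (Wd.selmerGroup 2) = 1 ∧
            ((W.Δ < 0 ∧ padicValNat 2 Wd.tamagawaProduct ≤ 1) ∨ padicValNat 2 Wd.tamagawaProduct = 0)) :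
    ∀ (W : WeierstrassCurve ℚ) [W.IsElliptic] [W.IsGloballyMinimal], ¬ W.HasCM → W.analyticRank = 1 →
      Nat.card (W.selmerGroup 2) = 2 → 0 < W.Δ → padicValNat 2 W.tamagawaProduct = 0 → BSDp W 2 := by
  intro W _ _ hcm hr hSel _hΔ hC0
  haveI : NeZero (W.conductorNorm ℤ) := ⟨(W.conductorNorm_pos_holds).ne'⟩
  have hT : Odd W.tamagawaProduct := by
    rcases Nat.even_or_odd W.tamagawaProduct with h | h
    · exfalso
      have h2 : 2 ∣ W.tamagawaProduct := even_iff_two_dvd.mp h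
      have h1 : 1 ≤ padicValNat 2 W.tamagawaProduct :=
        one_le_padicValNat_of_dvd W.tamagawaProduct_pos_holds.ne' h2
      omega
    · exact h
  obtain ⟨K, iF, iN, hK, hodd, h3, hH, Dt, β, ι, d₁, hc0, hy, ⟨M₀, hcM, hdiv, hndiv⟩, Wd, iE, iM, hWd, hSel1, hbudget⟩ :=
    hS2e W hcm hr hSel hT
  haveI hEK : (W.baseChange K).IsElliptic := isElliptic_baseChange' W K
  have hD0 : (NumberField.discr K : ℚ) ≠ 0 := by exact_mod_cast NumberField.discr_ne_zero K
  haveI hEt : (W.quadraticTwist (NumberField.discr K : ℚ)).IsElliptic := W.isElliptic_quadraticTwist hD0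
  obtain ⟨Cd, hCd⟩ := hWd
  -- the twin is non-CM (same `j`) of analytic rank `0`: `BSD₂(Wd)` from S1
  have hcmd : ¬ Wd.HasCM := by
    rw [← hCd, hasCM_iff_of_j_eq (((W.quadraticTwist (NumberField.discr K : ℚ)).variableChange_j Cd).trans (W.j_quadraticTwist hD0))]
    exact hcm
  obtain ⟨P₀, Hd, hP₀, hP₀K⟩ := exists_heegnerPoint_map_eq_derivedPoint_one hK hH d₁
  have hPinf : ¬ IsOfFinAddOrder P₀ := by
    intro hfin
    apply hy
    rw [← hP₀K]
    exact (WeierstrassCurve.Affine.Point.map (W' := W)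
      (algebraMap K (ringClassField K ι 1)).toRatAlgHom).isOfFinAddOrder hfin
  have hrt : (W.quadraticTwist (NumberField.discr K : ℚ)).analyticRank = 0 :=
    analyticRank_twist_eq_zero_of_rankOne W K (hGZ _ W K) hmod hK hH hr ⟨Dt, Hd, ι, hP₀⟩ hPinf
  have hrd : Wd.analyticRank = 0 := by rw [← hCd, analyticRank_smul, hrt]
  have hΔd : 0 < Wd.Δ := (Δ_twin_pos_iff W hD0 Cd hCd).mpr _hΔ
  have hC0d : padicValNat 2 Wd.tamagawaProduct = 0 := by
    rcases hbudget with ⟨hneg, -⟩ | h0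
    · exact absurd _hΔ (not_lt.mpr hneg.le)
    · exact h0
  have hBd : BSDp Wd 2 := hS1pos Wd hcmd hrd hSel1 hΔd hC0d
  exact swappedPairDescentAtTwo_maninExponent_of_facts hGZ hGZK hmod hMilneC W hr hSel hT K hK hodd h3 hH Dt hc0 β ι d₁ hy M₀ hcM
    hdiv hndiv Wd ⟨Cd, hCd⟩ hSel1 hbudget hBd

/-- **`hTw1 ⟸ S1⁻ + S2⁻′ + PRINT`** — `OneBit.hTw1_of_wall_of_reversedSupplyDepthOnePrime_of_facts` (p767140) with S1 sliced to
S1⁻ = (`r_an = 0`, `#Sel₂ = 1`, `Δ < 0`, `ord₂ C = 2`): the prime-frame twin of a `Δ < 0`, `ord₂ C(W) = 1` curve has `Δ(Wd) < 0` and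
`ord₂ C(Wd) = ord₂ C(W) + 1 = 2`.  [cite: GrossZagier1986, V.§2 (2.2)] [cite: Kramer1981, §2 Prop. 3] [cite: Miller2011LMS, Def. 1.1] -/
theorem hTw1_of_slicedWall_of_reversedSupplyDepthOnePrime_of_facts
    (hGZ : ∀ (N : ℕ) [NeZero N] (W : WeierstrassCurve ℚ) (K : Type) [Field K] [NumberField K], gross_zagier N W K)
    (hGZK : rank_eq_analyticRank_of_analyticRank_le_one) (hmod : hasEntireLFunction_rat)
    (hMilneC : Milne1972.bsdQuotient_baseChange_quadratic_anyModel)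
    (hS1neg : ∀ (W : WeierstrassCurve ℚ) [W.IsElliptic] [W.IsGloballyMinimal],
      ¬ W.HasCM → W.analyticRank = 0 → Nat.card (W.selmerGroup 2) = 1 → W.Δ < 0 → padicValNat 2 W.tamagawaProduct = 2 → BSDp W 2)
    (hS2p : ∀ (W : WeierstrassCurve ℚ) [W.IsElliptic] [W.IsGloballyMinimal] [NeZero (W.conductorNorm ℤ)],
      ¬ W.HasCM → W.analyticRank = 1 → Nat.card (W.selmerGroup 2) = 2 → W.Δ < 0 → padicValNat 2 W.tamagawaProduct = 1 →
      ∃ (K : Type) (_ : Field K) (_ : NumberField K),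
        IsImaginaryQuadratic K ∧ (∃ ℓ : ℕ, ℓ.Prime ∧ NumberField.discr K = -(ℓ : ℤ)) ∧ Odd (NumberField.discr K) ∧
        NumberField.discr K ≠ -3 ∧ SatisfiesHeegnerHypothesis (W.conductorNorm ℤ) K ∧
        ∃ (Dt : ModularParametrizationData W (W.conductorNorm ℤ)) (β : ℤ) (ι : K →+* ℂ) (d₁ : KolyvaginHeegnerData Dt β ι 1),
          Dt.c ≠ 0 ∧ ¬ IsOfFinAddOrder d₁.derivedPoint ∧
          (∃ Q : (W.baseChange (ringClassField K ι 1)).toAffine.Point,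
            ((2 ^ (padicValInt 2 Dt.c + 1) : ℕ) : ℤ) • Q = d₁.derivedPoint) ∧
          (¬ ∃ Q : (W.baseChange (ringClassField K ι 1)).toAffine.Point,
            ((2 ^ (padicValInt 2 Dt.c + 1 + 1) : ℕ) : ℤ) • Q = d₁.derivedPoint) ∧
          ∃ (Wd : WeierstrassCurve ℚ) (_ : Wd.IsElliptic) (_ : Wd.IsGloballyMinimal),
            (∃ C : WeierstrassCurve.VariableChange ℚ, C • W.quadraticTwist (NumberField.discr K : ℚ) = Wd) ∧
            Nat.card (Wd.selmerGroup 2) = 1) :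
    ∀ (W : WeierstrassCurve ℚ) [W.IsElliptic] [W.IsGloballyMinimal], ¬ W.HasCM → W.analyticRank = 1 →
      Nat.card (W.selmerGroup 2) = 2 → W.Δ < 0 → padicValNat 2 W.tamagawaProduct = 1 → BSDp W 2 := by
  intro W _ _ hcm hr hSel hΔ hC1
  haveI : NeZero (W.conductorNorm ℤ) := ⟨(W.conductorNorm_pos_holds).ne'⟩
  obtain ⟨K, iF, iN, hK, ⟨ℓ, hℓ, hd⟩, hodd, h3, hH, Dt, β, ι, d₁, hc0, hy, hdiv, hndiv, Wd, iE, iM, hWd, hSel1⟩ :=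
    hS2p W hcm hr hSel hΔ hC1
  haveI hEK : (W.baseChange K).IsElliptic := isElliptic_baseChange' W K
  have hD0 : (NumberField.discr K : ℚ) ≠ 0 := by exact_mod_cast NumberField.discr_ne_zero K
  haveI hEt : (W.quadraticTwist (NumberField.discr K : ℚ)).IsElliptic := W.isElliptic_quadraticTwist hD0
  obtain ⟨Cd, hCd⟩ := hWd
  have hsucc := padicValNat_two_tamagawaProduct_twin_eq_succ_of_discr_eq_neg_prime W hK hodd hH hℓ hd hΔ Cd hCd
  have hDEF : padicValNat 2 Wd.tamagawaProduct ≤ padicValNat 2 W.tamagawaProduct + 1 := hsucc.le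
  have hC2d : padicValNat 2 Wd.tamagawaProduct = 2 := by rw [hsucc, hC1]
  have hΔd : Wd.Δ < 0 := (Δ_twin_neg_iff W hD0 Cd hCd).mpr hΔ
  have hdiv' : ∃ Q : (W.baseChange (ringClassField K ι 1)).toAffine.Point,
      ((2 ^ (padicValInt 2 Dt.c + padicValNat 2 W.tamagawaProduct) : ℕ) : ℤ) • Q = d₁.derivedPoint := by rw [hC1]; exact hdiv
  have hndiv' : ¬ ∃ Q : (W.baseChange (ringClassField K ι 1)).toAffine.Point,
      ((2 ^ (padicValInt 2 Dt.c + padicValNat 2 W.tamagawaProduct + 1) : ℕ) : ℤ) • Q = d₁.derivedPoint := by rw [hC1]; exact hndiv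
  have hcmd : ¬ Wd.HasCM := by
    rw [← hCd, hasCM_iff_of_j_eq (((W.quadraticTwist (NumberField.discr K : ℚ)).variableChange_j Cd).trans (W.j_quadraticTwist hD0))]
    exact hcm
  obtain ⟨hrd, -⟩ := padicValRat_shaAn_and_shaOrder_of_swappedPair_of_le_succ W K (hGZ _ W K) hGZK hmod hr hSel hΔ hK hodd h3 hH Dt
    hc0 β ι d₁ hy hdiv' hndiv' Wd Cd hCd hSel1 hDEF
  have hBd : BSDp Wd 2 := hS1neg Wd hcmd hrd hSel1 hΔd hC2d
  exact swappedPairDescentAtTwo_tamagawaDepth_of_facts hGZ hGZK hmod hMilneC W hr hSel hΔ K hK hodd h3 hH Dt hc0 β ι d₁ hy hdiv' hndiv'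
    Wd ⟨Cd, hCd⟩ hSel1 hDEF hBd

/-! ## §2 `closes` (rev 57) with U₂ replaced by the (sliced) wall and the two reversed supplies -/

/-- **THE ROUTE LEDGER ON REV 57: U₂ ↦ «SLICED WALL + S2″ + S2⁻′».**  `Line25.nonCMAtTwo_of_items_of_tamagawaSlicedTwin_line25` (= `closes`
rev 57 with `hTw` sliced) fed by §1: `hTw0` from S1⁺ + S2″ + PRINT, `hTw1` from S1⁻ + S2⁻′ + PRINT.  All other binders = the route's items as in
`closes` (rev 57).  CONDITIONAL on the displayed hypotheses; proves nothing about BSD by itself; closes no item.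
[cite: GrossZagier1986, V.§2 (2.2)] [cite: Kramer1981, Thm. 1, §2 Prop. 3] [cite: Miller2011LMS, Def. 1.1] -/
theorem nonCMAtTwo_of_items_of_slicedWall_of_reversedSupplies_line25
    (hP : GenusPrimitiveSupplyAtTwoPosDiscShallow) (hPG : GenusDeepSupplyAtTwoNegDiscNarrow) (hQ1 : CyclicTorsionOfNegDisc)
    (hQ2 : KolyvaginRelationAtTwo)
    (hQ5R : EquivariantChebotarevAtTwoR) (hQ3RT : EquivariantKolyvaginExactAtTwoRT)
    (hQ4T : KolyvaginExactAtTwoPosDiscT) (hGf : ExactDescentAtTwoOfFourFacts)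
    (hR : OffHabitatResidualAtTwo) (hOff : OffCutResidualAtTwoR)
    (hK1P : K1Pos) (hK1N : K1Neg) (hSha1 : ShaVanishingAtDepthZeroAtTwo)
    (hS1pos : ∀ (W : WeierstrassCurve ℚ) [W.IsElliptic] [W.IsGloballyMinimal],
      ¬ W.HasCM → W.analyticRank = 0 → Nat.card (W.selmerGroup 2) = 1 → 0 < W.Δ → padicValNat 2 W.tamagawaProduct = 0 → BSDp W 2)
    (hS1neg : ∀ (W : WeierstrassCurve ℚ) [W.IsElliptic] [W.IsGloballyMinimal],
      ¬ W.HasCM → W.analyticRank = 0 → Nat.card (W.selmerGroup 2) = 1 → W.Δ < 0 → padicValNat 2 W.tamagawaProduct = 2 → BSDp W 2)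
    (hS2e : ∀ (W : WeierstrassCurve ℚ) [W.IsElliptic] [W.IsGloballyMinimal] [NeZero (W.conductorNorm ℤ)],
      ¬ W.HasCM → W.analyticRank = 1 → Nat.card (W.selmerGroup 2) = 2 → Odd W.tamagawaProduct →
      ∃ (K : Type) (_ : Field K) (_ : NumberField K),
        IsImaginaryQuadratic K ∧ Odd (NumberField.discr K) ∧ NumberField.discr K ≠ -3 ∧ SatisfiesHeegnerHypothesis (W.conductorNorm ℤ) K ∧
        ∃ (Dt : ModularParametrizationData W (W.conductorNorm ℤ)) (β : ℤ) (ι : K →+* ℂ) (d₁ : KolyvaginHeegnerData Dt β ι 1),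
          Dt.c ≠ 0 ∧ ¬ IsOfFinAddOrder d₁.derivedPoint ∧
          (∃ M₀ : ℕ, padicValInt 2 Dt.c = M₀ ∧
            (∃ Q : (W.baseChange (ringClassField K ι 1)).toAffine.Point, ((2 ^ M₀ : ℕ) : ℤ) • Q = d₁.derivedPoint) ∧
            (¬ ∃ Q : (W.baseChange (ringClassField K ι 1)).toAffine.Point, ((2 ^ (M₀ + 1) : ℕ) : ℤ) • Q = d₁.derivedPoint)) ∧
          ∃ (Wd : WeierstrassCurve ℚ) (_ : Wd.IsElliptic) (_ : Wd.IsGloballyMinimal),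
            (∃ C : VariableChange ℚ, C • W.quadraticTwist (NumberField.discr K : ℚ) = Wd) ∧ Nat.card (Wd.selmerGroup 2) = 1 ∧
            ((W.Δ < 0 ∧ padicValNat 2 Wd.tamagawaProduct ≤ 1) ∨ padicValNat 2 Wd.tamagawaProduct = 0))
    (hS2p : ∀ (W : WeierstrassCurve ℚ) [W.IsElliptic] [W.IsGloballyMinimal] [NeZero (W.conductorNorm ℤ)],
      ¬ W.HasCM → W.analyticRank = 1 → Nat.card (W.selmerGroup 2) = 2 → W.Δ < 0 → padicValNat 2 W.tamagawaProduct = 1 →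
      ∃ (K : Type) (_ : Field K) (_ : NumberField K),
        IsImaginaryQuadratic K ∧ (∃ ℓ : ℕ, ℓ.Prime ∧ NumberField.discr K = -(ℓ : ℤ)) ∧ Odd (NumberField.discr K) ∧
        NumberField.discr K ≠ -3 ∧ SatisfiesHeegnerHypothesis (W.conductorNorm ℤ) K ∧
        ∃ (Dt : ModularParametrizationData W (W.conductorNorm ℤ)) (β : ℤ) (ι : K →+* ℂ) (d₁ : KolyvaginHeegnerData Dt β ι 1),
          Dt.c ≠ 0 ∧ ¬ IsOfFinAddOrder d₁.derivedPoint ∧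
          (∃ Q : (W.baseChange (ringClassField K ι 1)).toAffine.Point,
            ((2 ^ (padicValInt 2 Dt.c + 1) : ℕ) : ℤ) • Q = d₁.derivedPoint) ∧
          (¬ ∃ Q : (W.baseChange (ringClassField K ι 1)).toAffine.Point,
            ((2 ^ (padicValInt 2 Dt.c + 1 + 1) : ℕ) : ℤ) • Q = d₁.derivedPoint) ∧
          ∃ (Wd : WeierstrassCurve ℚ) (_ : Wd.IsElliptic) (_ : Wd.IsGloballyMinimal),
            (∃ C : WeierstrassCurve.VariableChange ℚ, C • W.quadraticTwist (NumberField.discr K : ℚ) = Wd) ∧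
            Nat.card (Wd.selmerGroup 2) = 1)
    (hL : EntireLFunctionRat)
    (hGZ : GrossZagierAllLevels) (hGZK : MultPublishedInputsAtTwo) (hMi : MilneAnyModel) :
    NonCMAtTwo :=
  nonCMAtTwo_of_items_of_tamagawaSlicedTwin_line25 hP hPG hQ1 hQ2 hQ5R hQ3RT hQ4T hGf hR hOff hK1P hK1N hSha1
    (hTw0_of_slicedWall_of_reversedSupplyExponent_of_facts hGZ hGZK hL hMi hS1pos hS2e)
    (hTw1_of_slicedWall_of_reversedSupplyDepthOnePrime_of_facts hGZ hGZK hL hMi hS1neg hS2p) hL hGZ hGZK hMi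

/-- **THE ROUTE LEDGER ON REV 57: U₂ ↦ «WALL + S2″ + S2⁻′»** with the unsliced wall S1 = LINE 23's anchor `MinimalRankZeroBSDTwo` verbatim
(`BSD₂` for non-CM globally minimal `W` with `r_an = 0`, `#Sel₂ = 1`) — the rev-57 successor of `Ledger.nonCMAtTwo_of_items_of_wall_of_reversedSupplies`
(p767868).  CONDITIONAL on the displayed hypotheses; proves nothing about BSD by itself; closes no item.
[cite: GrossZagier1986, V.§2 (2.2)] [cite: Kramer1981, Thm. 1, §2 Prop. 3] [cite: Miller2011LMS, Def. 1.1] -/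
theorem nonCMAtTwo_of_items_of_wall_of_reversedSupplies_line25
    (hP : GenusPrimitiveSupplyAtTwoPosDiscShallow) (hPG : GenusDeepSupplyAtTwoNegDiscNarrow) (hQ1 : CyclicTorsionOfNegDisc)
    (hQ2 : KolyvaginRelationAtTwo)
    (hQ5R : EquivariantChebotarevAtTwoR) (hQ3RT : EquivariantKolyvaginExactAtTwoRT)
    (hQ4T : KolyvaginExactAtTwoPosDiscT) (hGf : ExactDescentAtTwoOfFourFacts)
    (hR : OffHabitatResidualAtTwo) (hOff : OffCutResidualAtTwoR)
    (hK1P : K1Pos) (hK1N : K1Neg) (hSha1 : ShaVanishingAtDepthZeroAtTwo)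
    (hS1 : ∀ (W : WeierstrassCurve ℚ) [W.IsElliptic] [W.IsGloballyMinimal],
      ¬ W.HasCM → W.analyticRank = 0 → Nat.card (W.selmerGroup 2) = 1 → BSDp W 2)
    (hS2e : ∀ (W : WeierstrassCurve ℚ) [W.IsElliptic] [W.IsGloballyMinimal] [NeZero (W.conductorNorm ℤ)],
      ¬ W.HasCM → W.analyticRank = 1 → Nat.card (W.selmerGroup 2) = 2 → Odd W.tamagawaProduct →
      ∃ (K : Type) (_ : Field K) (_ : NumberField K),
        IsImaginaryQuadratic K ∧ Odd (NumberField.discr K) ∧ NumberField.discr K ≠ -3 ∧ SatisfiesHeegnerHypothesis (W.conductorNorm ℤ) K ∧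
        ∃ (Dt : ModularParametrizationData W (W.conductorNorm ℤ)) (β : ℤ) (ι : K →+* ℂ) (d₁ : KolyvaginHeegnerData Dt β ι 1),
          Dt.c ≠ 0 ∧ ¬ IsOfFinAddOrder d₁.derivedPoint ∧
          (∃ M₀ : ℕ, padicValInt 2 Dt.c = M₀ ∧
            (∃ Q : (W.baseChange (ringClassField K ι 1)).toAffine.Point, ((2 ^ M₀ : ℕ) : ℤ) • Q = d₁.derivedPoint) ∧
            (¬ ∃ Q : (W.baseChange (ringClassField K ι 1)).toAffine.Point, ((2 ^ (M₀ + 1) : ℕ) : ℤ) • Q = d₁.derivedPoint)) ∧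
          ∃ (Wd : WeierstrassCurve ℚ) (_ : Wd.IsElliptic) (_ : Wd.IsGloballyMinimal),
            (∃ C : VariableChange ℚ, C • W.quadraticTwist (NumberField.discr K : ℚ) = Wd) ∧ Nat.card (Wd.selmerGroup 2) = 1 ∧
            ((W.Δ < 0 ∧ padicValNat 2 Wd.tamagawaProduct ≤ 1) ∨ padicValNat 2 Wd.tamagawaProduct = 0))
    (hS2p : ∀ (W : WeierstrassCurve ℚ) [W.IsElliptic] [W.IsGloballyMinimal] [NeZero (W.conductorNorm ℤ)],
      ¬ W.HasCM → W.analyticRank = 1 → Nat.card (W.selmerGroup 2) = 2 → W.Δ < 0 → padicValNat 2 W.tamagawaProduct = 1 →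
      ∃ (K : Type) (_ : Field K) (_ : NumberField K),
        IsImaginaryQuadratic K ∧ (∃ ℓ : ℕ, ℓ.Prime ∧ NumberField.discr K = -(ℓ : ℤ)) ∧ Odd (NumberField.discr K) ∧
        NumberField.discr K ≠ -3 ∧ SatisfiesHeegnerHypothesis (W.conductorNorm ℤ) K ∧
        ∃ (Dt : ModularParametrizationData W (W.conductorNorm ℤ)) (β : ℤ) (ι : K →+* ℂ) (d₁ : KolyvaginHeegnerData Dt β ι 1),
          Dt.c ≠ 0 ∧ ¬ IsOfFinAddOrder d₁.derivedPoint ∧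
          (∃ Q : (W.baseChange (ringClassField K ι 1)).toAffine.Point,
            ((2 ^ (padicValInt 2 Dt.c + 1) : ℕ) : ℤ) • Q = d₁.derivedPoint) ∧
          (¬ ∃ Q : (W.baseChange (ringClassField K ι 1)).toAffine.Point,
            ((2 ^ (padicValInt 2 Dt.c + 1 + 1) : ℕ) : ℤ) • Q = d₁.derivedPoint) ∧
          ∃ (Wd : WeierstrassCurve ℚ) (_ : Wd.IsElliptic) (_ : Wd.IsGloballyMinimal),
            (∃ C : WeierstrassCurve.VariableChange ℚ, C • W.quadraticTwist (NumberField.discr K : ℚ) = Wd) ∧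
            Nat.card (Wd.selmerGroup 2) = 1)
    (hL : EntireLFunctionRat)
    (hGZ : GrossZagierAllLevels) (hGZK : MultPublishedInputsAtTwo) (hMi : MilneAnyModel) :
    NonCMAtTwo :=
  nonCMAtTwo_of_items_of_slicedWall_of_reversedSupplies_line25 hP hPG hQ1 hQ2 hQ5R hQ3RT hQ4T hGf hR hOff hK1P hK1N hSha1
    (fun W _ _ hcm hr hSel _ _ ↦ hS1 W hcm hr hSel) (fun W _ _ hcm hr hSel _ _ ↦ hS1 W hcm hr hSel) hS2e hS2p hL hGZ hGZK hMi

end Summit.BirchSwinnertonDyer.BirchSwinnertonDyer.Theorems.GenusExact.TwinSwap.Ledger.Line25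

end
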